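import Mathlib
import HarnessLib
import HarnessLib.Audit
import Summits.ABC.ABC.Theses.IneffectiveSubspace
import Literature.NumberTheory.DiophantineGeometry.AbcImpliesHall
import Literature.Barriers.ABC.BakerMethodBounds

/-!
# Line `binomial-xi-d-zero-threefold` — crux `IneffectiveSubspace.TowerExponentWindow` (stmt-ABC-1647) — skeleton v2

Lead prover `prover-line-stmt-ABC-1647-0` (2026-08-16), RESHAPED from the planner's skeleton (crux-plan
planner-cruxplan-stmt-ABC-1647-binomial-xi-d-zero-t-0, sha 649a09b0): the lever and the dictionary are restated with
SEPARATE coefficients, which weakens the lever to exactly what the composition consumes.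

THE CRUX. `TowerExponentWindow`: at SOME level `n ≥ 1` Vojta's tower inequality holds with SOME exponent
`0 < A < n/3` — equivalently POLYNOMIAL abc `c < K·rad(abc)^θ` (route item `WindowGivesPolynomialAbc` and
`tower_of_polyAbc` below).

THE LINE (unchanged idea). Write a level-`n` tower point as `u·Xⁿ + v·Yⁿ = w·Zⁿ`. At the primes of `Y` the binomial
`uXⁿ − wZⁿ = −vYⁿ` is deep: the linear form `log(u/w) + n·log(X/Z)` in TWO rational logarithms is `p`-adically small at
all primes of `Y` at once. LEVER v2 (`DepthWindow3`, stub A3 = `stub_depthWindow3`): at ONE level `n`, every divisor `d`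
of `a₁a₂ⁿ − c₁c₂ⁿ` (coprime positive data) has `log d ≤ A₁·h₁ + A₂·h₂ + C₂·log rad d + C'` (`h₁ = log max(a₁,c₁)`,
`h₂ = log max(a₂,c₂)`) with nonnegative coefficients and the WINDOW `A₂ + C₂ < n` — `A₁` FREE. The trivial Liouville
bound `d ≤ |a₁a₂ⁿ − c₁c₂ⁿ| ≤ max(a₁,c₁)·max(a₂,c₂)ⁿ` is `(A₁,A₂,C₂) = (1,n,0)`, ON the boundary: the lever asks for
any saving over Liouville in the `h₂`-coefficient, paid for by `log rad d` (Baker–Wüstholz (i): places coupled, weight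
`log p`) and by any multiple of `h₁`. DICTIONARY v2 (stub B3 = `stub_flatBoundOfDepth3`, PROVED by the lead below and
as tree file `Theorems/IneffectiveSubspaceTowerExponentWindowFlatBoundOfDepth3.lean`): lever at level `n` ⟹ Vojta's
`D = 0` flat bound `wZⁿ ≤ K(uvw)^κ` (apply the lever at `(u,X,w,Z)`, `d = Yⁿ` and at `(v,Y,w,Z)`, `d = Xⁿ`, take the
MAXIMUM — disprover's mutation — and use `wZⁿ ≤ 2·max(uXⁿ,vYⁿ)`). LIFT (stub C = `stub_polyAbcOfFlatBound`, unchanged,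
LANDED p76341 as `Summit.ABC.ABC.Theorems.stub_polyAbcOfFlatBound`): flat bound at level `n ≥ 1` ⟹ polynomial abc.
Composition `TowerExponentWindow_of` (kernel-checked, concludes the crux BY NAME) via `tower_of_polyAbc`.

WHAT THE RESHAPING SHOWS (proved below, `depthWindow3_of_polyAbc`): polynomial abc with exponent `κ` gives the v2
lever at every level `n > 3·max κ 1` (`(A₁,A₂,C₂) = (3 − 1/k, 2 + n(1 − 1/k), 1)`, `k = max κ 1`; abc applied to the
triple `(|P − Q|, min, max)`). Hence, modulo the lift C (bookkeeping, landed) and route item 1653 (crux ⟹ PolyABC,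
candidate proof in Disproof.lean): **lever v2 ⟺ PolyABC ⟺ crux** (`depthWindow3_iff_polyAbc`). The line is a
conditional REFORMULATION of the crux in Baker–Wüstholz Ξ-coordinates — it cannot be cheaper than the crux; its value
is the certified dictionary and the precise transcendence target. The planner's lever (v1, `BinomialDepthWindow`: one
constant `C`, window `3C < n`) implies v2 (`depthWindow3_of_binomialDepthWindow`), is implied by `ABC`
(`binomialDepthWindow_of_abc`, planner, kept verbatim) and by PolyABC only for `κ < 3/2` (Disproof.lean (d)).

Registered stubs (v2): `stub_depthWindow3` [LEVER, OPEN — conjecture-strength, crux-equivalent], `stub_flatBoundOfDepth3`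
[proved, lead], `stub_polyAbcOfFlatBound` [landed, worker]. `sorry` occurs ONLY in the three `stub_*` theorems.
Disproof.lean used: (a) coprimality/positivity load-bearing — v2 keeps both; (b) floors (v1: `n ≥ 7`, `C ∈ [2, n/3)`);
for v2 the same families give (paper-level, `log rad d` is constant along each family so `C₂` drops out):
LTE `(2^m+1, 1, 1, 1)`, `d = 2^m` ⟹ `A₁ ≥ 1`; Gaussian/Eisenstein (`a₁ = c₁ = 1`, `d = 5^m` resp. `7^m`) ⟹ `A₂ ≥ 2` at
`4 ∣ n`, `6 ∣ n`; Padé (`d = t^(2n−1)`, `h₁ ≈ (n−1) log t`, `h₂ ≈ log t`) ⟹ `(n−1)A₁ + A₂ ≥ 2n − 1` — absorbed by the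
free `A₁`; and `d = |D|` itself forces `C₂ > 0` (else `A₂ ≥ n`). All consistent with the abc-ceiling
`(A₁, A₂, C₂) = (3 − 1/k, 2 + n(1−1/k), 1)`; (d) the mutation `2C < n` — adopted (case `A₁ = A₂ = C₂ = C` of v2);
(e) mechanism obstruction — untouched (no Schmidt-shape input here).
-/

namespace Summit.ABC.ABC.Cruxes.TowerExponentWindow.BinomialXiDZeroThreefold

open scoped BigOperators
open Literature.NumberTheory.DiophantineGeometry

/-! ## The statements of the line (named `Prop`s) -/

/-- **Binomial depth inequality at level `n` with one constant `(C, C')`** (planner's v1 matrix, kept for the record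
and for `binomialDepthWindow_of_abc`). [BakerWustholz2007 §3.7; Vojta2000ABC §7] -/
def DepthIneq (n : ℕ) (C C' : ℝ) : Prop :=
  ∀ a₁ a₂ c₁ c₂ : ℕ, 0 < a₁ → 0 < a₂ → 0 < c₁ → 0 < c₂ → Nat.Coprime (a₁ * a₂) (c₁ * c₂) →
    a₁ * a₂ ^ n ≠ c₁ * c₂ ^ n →
    ∀ d : ℕ, 0 < d → (d : ℤ) ∣ ((a₁ * a₂ ^ n : ℕ) : ℤ) - ((c₁ * c₂ ^ n : ℕ) : ℤ) →
      Real.log (d : ℝ) ≤ C * (Real.log ((max a₁ c₁ : ℕ) : ℝ) + Real.log ((max a₂ c₂ : ℕ) : ℝ) +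
        Real.log ((UniqueFactorizationMonoid.radical d : ℕ) : ℝ)) + C'

/-- **Refined binomial depth inequality at level `n`** with separate coefficients: `A₁` on `h₁ = log max(a₁,c₁)`,
`A₂` on `h₂ = log max(a₂,c₂)`, `C₂` on `log rad d`. Trivially true with `(A₁,A₂,C₂,C') = (1,n,0,0)` (Liouville). -/
def DepthIneq3 (n : ℕ) (A₁ A₂ C₂ C' : ℝ) : Prop :=
  ∀ a₁ a₂ c₁ c₂ : ℕ, 0 < a₁ → 0 < a₂ → 0 < c₁ → 0 < c₂ → Nat.Coprime (a₁ * a₂) (c₁ * c₂) → a₁ * a₂ ^ n ≠ c₁ * c₂ ^ n → ∀ d : ℕ, 0 < d → (d : ℤ) ∣ ((a₁ * a₂ ^ n : ℕ) : ℤ) - ((c₁ * c₂ ^ n : ℕ) : ℤ) → Real.log (d : ℝ) ≤ A₁ * Real.log ((max a₁ c₁ : ℕ) : ℝ) + A₂ * Real.log ((max a₂ c₂ : ℕ) : ℝ) + C₂ * Real.log ((UniqueFactorizationMonoid.radical d : ℕ) : ℝ) + C'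

/-- **Stub A (v1) · `BinomialDepthWindow`** — the planner's lever: one level `n`, constants `0 ≤ C < n/3`. Implies v2. -/
def BinomialDepthWindow : Prop :=
  ∃ n : ℕ, ∃ C C' : ℝ, 0 ≤ C ∧ 3 * C < n ∧ DepthIneq n C C'

/-- **Stub A3 (v2) · `DepthWindow3`** (the LEVER; OPEN; conjecture-strength; crux-EQUIVALENT modulo bookkeeping):
one level `n` and nonnegative coefficients with `A₂ + C₂ < n` such that `DepthIneq3 n A₁ A₂ C₂ C'`. -/
def DepthWindow3 : Prop :=
  ∃ n : ℕ, ∃ A₁ A₂ C₂ C' : ℝ, 0 ≤ A₁ ∧ 0 ≤ A₂ ∧ 0 ≤ C₂ ∧ A₂ + C₂ < n ∧ ∀ a₁ a₂ c₁ c₂ : ℕ, 0 < a₁ → 0 < a₂ → 0 < c₁ → 0 < c₂ → Nat.Coprime (a₁ * a₂) (c₁ * c₂) → a₁ * a₂ ^ n ≠ c₁ * c₂ ^ n → ∀ d : ℕ, 0 < d → (d : ℤ) ∣ ((a₁ * a₂ ^ n : ℕ) : ℤ) - ((c₁ * c₂ ^ n : ℕ) : ℤ) → Real.log (d : ℝ)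 ≤ A₁ * Real.log ((max a₁ c₁ : ℕ) : ℝ) + A₂ * Real.log ((max a₂ c₂ : ℕ) : ℝ) + C₂ * Real.log ((UniqueFactorizationMonoid.radical d : ℕ) : ℝ) + C'

/-- **Vojta's `D = 0` inequality at level `n`** ("flat bound"): `wZⁿ ≤ K·(uvw)^κ` on positive solutions of
`uXⁿ + vYⁿ = wZⁿ` with `gcd(uXⁿ, vYⁿ) = 1`. False for `n ≤ 3`; implied by abc for `n ≥ 4`. [Vojta2000ABC §7] -/
def FlatBound (n : ℕ) : Prop :=
  ∃ κ K : ℝ, ∀ u v w X Y Z : ℕ, 0 < u → 0 < v → 0 < w → 0 < X → 0 < Y → 0 < Z → u * X ^ n + v * Y ^ n = w * Z ^ n → Nat.Coprime (u * X ^ n) (v * Y ^ n) → ((w * Z ^ n : ℕ) : ℝ) ≤ K * ((u * v * w : ℕ) : ℝ) ^ κ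

/-- **Polynomial abc** — verbatim the conclusion of route item `WindowGivesPolynomialAbc` (stmt-ABC-1653). -/
def PolyABC : Prop :=
  ∃ κ C : ℝ, 0 < C ∧ ∀ a b c : ℕ, Literature.NumberTheory.DiophantineGeometry.IsABCTriple a b c → (c : ℝ) < C * ((Literature.NumberTheory.DiophantineGeometry.rad a b c : ℕ) : ℝ) ^ κ

/-- **Stub B3 (v2) · `FlatBoundOfDepth3`** (the refined DICTIONARY; PROVED by the lead): for `0 ≤ A₁, A₂, C₂`,
`A₂ + C₂ < n`: `DepthIneq3 n A₁ A₂ C₂ C' → FlatBound n`. -/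
def FlatBoundOfDepth3 : Prop :=
  ∀ n : ℕ, ∀ A₁ A₂ C₂ C' : ℝ, 0 ≤ A₁ → 0 ≤ A₂ → 0 ≤ C₂ → A₂ + C₂ < n → DepthIneq3 n A₁ A₂ C₂ C' → FlatBound n

/-- **Stub C · `PolyAbcOfFlatBound`** (Vojta's canonical lift at the top coordinate; LANDED p76341): for `n ≥ 1`,
`FlatBound n → PolyABC`. [Vojta2000ABC §3.1] -/
def PolyAbcOfFlatBound : Prop :=
  ∀ n : ℕ, 1 ≤ n → FlatBound n → PolyABC

/-! ## Registered stubs (v2) — `sorry` lives ONLY in these three theorems -/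

/-- Stub A3, registered form (= def `DepthWindow3`, unfolded). -/
theorem stub_depthWindow3 : ∃ n : ℕ, ∃ A₁ A₂ C₂ C' : ℝ, 0 ≤ A₁ ∧ 0 ≤ A₂ ∧ 0 ≤ C₂ ∧ A₂ + C₂ < n ∧ ∀ a₁ a₂ c₁ c₂ : ℕ, 0 < a₁ → 0 < a₂ → 0 < c₁ → 0 < c₂ → Nat.Coprime (a₁ * a₂) (c₁ * c₂) → a₁ * a₂ ^ n ≠ c₁ * c₂ ^ n → ∀ d : ℕ, 0 < d → (d : ℤ) ∣ ((a₁ * a₂ ^ n : ℕ) : ℤ) - ((c₁ * c₂ ^ n : ℕ) : ℤ) → Real.log (d : ℝ) ≤ A₁ * Real.log ((max a₁ c₁ : ℕ) : ℝ) + A₂ * Real.log ((max a₂ c₂ : ℕ) : ℝ) + C₂ * Real.log ((UniqueFactorizationMonoid.radical d : ℕ) : ℝ) + C' := by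
  sorry

/-- Stub B3, registered form (= def `FlatBoundOfDepth3`, unfolded). -/
theorem stub_flatBoundOfDepth3 : ∀ n : ℕ, ∀ A₁ A₂ C₂ C' : ℝ, 0 ≤ A₁ → 0 ≤ A₂ → 0 ≤ C₂ → A₂ + C₂ < n → (∀ a₁ a₂ c₁ c₂ : ℕ, 0 < a₁ → 0 < a₂ → 0 < c₁ → 0 < c₂ → Nat.Coprime (a₁ * a₂) (c₁ * c₂) → a₁ * a₂ ^ n ≠ c₁ * c₂ ^ n → ∀ d : ℕ, 0 < d → (d : ℤ) ∣ ((a₁ * a₂ ^ n : ℕ) : ℤ) - ((c₁ * c₂ ^ n : ℕ) : ℤ) → Real.log (d : ℝ) ≤ A₁ * Real.log ((max a₁ c₁ : ℕ) : ℝ) + A₂ * Real.log ((max a₂ c₂ : ℕ) : ℝ) + C₂ * Real.log ((UniqueFactorizationMonoid.radical d : ℕ) : ℝ) + C') → ∃ κ K : ℝ, ∀ u v w X Y Z : ℕ, 0 < u → 0 < v → 0 < w → 0 < X → 0 < Y → 0 < Z → u * X ^ n + v * Y ^ n = w * Z ^ n → Nat.Coprime (u * X ^ n) (v * Y ^ n)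 → ((w * Z ^ n : ℕ) : ℝ) ≤ K * ((u * v * w : ℕ) : ℝ) ^ κ := by
  sorry

/-- Stub C, registered form (= def `PolyAbcOfFlatBound`, unfolded; unchanged from v1). -/
theorem stub_polyAbcOfFlatBound : ∀ n : ℕ, 1 ≤ n → (∃ κ K : ℝ, ∀ u v w X Y Z : ℕ, 0 < u → 0 < v → 0 < w → 0 < X → 0 < Y → 0 < Z → u * X ^ n + v * Y ^ n = w * Z ^ n → Nat.Coprime (u * X ^ n) (v * Y ^ n) → ((w * Z ^ n : ℕ) : ℝ) ≤ K * ((u * v * w : ℕ) : ℝ) ^ κ) → ∃ κ C : ℝ, 0 < C ∧ ∀ a b c : ℕ, Literature.NumberTheory.DiophantineGeometry.IsABCTriple a b c → (c : ℝ) < C * ((Literature.NumberTheory.DiophantineGeometry.rad a b c : ℕ) : ℝ) ^ κ := by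
  sorry

/-! ### Consistency: each named statement IS its registered stub (definitional unfolding only) -/

theorem depthWindow3_holds : DepthWindow3 := stub_depthWindow3
theorem flatBoundOfDepth3_holds : FlatBoundOfDepth3 := stub_flatBoundOfDepth3
theorem polyAbcOfFlatBound_holds : PolyAbcOfFlatBound := stub_polyAbcOfFlatBound

/-! ### Name-keyed aliases of the three statements (hypotheses of the composition) -/
namespace Registered

/-- Alias of `DepthWindow3` keyed by the registered stub name. -/
abbrev stub_depthWindow3 : Prop := DepthWindow3
/-- Alias of `FlatBoundOfDepth3` keyed by the registered stub name. -/
abbrev stub_flatBoundOfDepth3 : Prop := FlatBoundOfDepth3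
/-- Alias of `PolyAbcOfFlatBound` keyed by the registered stub name. -/
abbrev stub_polyAbcOfFlatBound : Prop := PolyAbcOfFlatBound

end Registered

/-! ## Proved glue (no `sorry` below this line) -/

/-- The three stubs give polynomial abc. -/
theorem polyABC_of (hA : DepthWindow3) (hB : FlatBoundOfDepth3) (hC : PolyAbcOfFlatBound) : PolyABC := by
  obtain ⟨n, A₁, A₂, C₂, C', hA₁, hA₂, hC₂, hwin, hD⟩ := hA
  have h0 : (0 : ℝ) < (n : ℝ) := by linarith
  have hn : 0 < n := by exact_mod_cast h0
  exact hC n (Nat.succ_le_of_lt hn) (hB n A₁ A₂ C₂ C' hA₁ hA₂ hC₂ hwin hD)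

/-- **Polynomial abc gives the tower inequality at EVERY level, with exponent `max κ 1`** (converse of route
item `WindowGivesPolynomialAbc`; proved). For a tower point put `a = ∏ xᵢ^(i+1)` etc.; `(a, b, c)` is an abc
triple and `abc = ∏ (xᵢyᵢzᵢ)^(i+1) ∣ (∏ xᵢyᵢzᵢ)ⁿ`, so `rad(abc) ≤ ∏ xᵢyᵢzᵢ` (`radical_le_of_dvd_pow`), whence
`c < K·rad^κ ≤ K·rad^(max κ 1) ≤ K·Π^(max κ 1) ≤ K·Π^(max κ 1 + ε)`. -/
theorem tower_of_polyAbc {κ K : ℝ} (hK : 0 < K)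
    (hP : ∀ a b c : ℕ, IsABCTriple a b c → (c : ℝ) < K * ((rad a b c : ℕ) : ℝ) ^ κ)
    (n : ℕ) {ε : ℝ} (hε : 0 < ε) (x y z : Fin n → ℕ) (hpos : ∀ i, 0 < x i ∧ 0 < y i ∧ 0 < z i)
    (hsum : (∏ i, x i ^ (i.val + 1)) + (∏ i, y i ^ (i.val + 1)) = ∏ i, z i ^ (i.val + 1))
    (hcop : Nat.Coprime (∏ i, x i ^ (i.val + 1)) (∏ i, y i ^ (i.val + 1))) :
    ((∏ i, z i ^ (i.val + 1) : ℕ) : ℝ) < K * ((∏ i, x i * y i * z i : ℕ) : ℝ) ^ (max κ 1 + ε) := by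
  set a : ℕ := ∏ i, x i ^ (i.val + 1) with ha
  set b : ℕ := ∏ i, y i ^ (i.val + 1) with hb
  set c : ℕ := ∏ i, z i ^ (i.val + 1) with hc
  set P : ℕ := ∏ i, x i * y i * z i with hPdef
  have ha0 : 0 < a := Finset.prod_pos fun i _ => pow_pos (hpos i).1 _
  have hb0 : 0 < b := Finset.prod_pos fun i _ => pow_pos (hpos i).2.1 _
  have hP0 : 0 < P := Finset.prod_pos fun i _ => mul_pos (mul_pos (hpos i).1 (hpos i).2.1) (hpos i).2.2
  have habc : IsABCTriple a b c := ⟨ha0, hb0, hsum, hcop⟩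
  -- `abc ∣ P ^ n`, termwise: `(xᵢyᵢzᵢ)^(i+1) ∣ (xᵢyᵢzᵢ)^n` since `i + 1 ≤ n`
  have hdvd : a * b * c ∣ P ^ n := by
    rw [ha, hb, hc, hPdef, ← Finset.prod_mul_distrib, ← Finset.prod_mul_distrib, ← Finset.prod_pow]
    refine Finset.prod_dvd_prod_of_dvd _ _ fun i _ => ?_
    rw [← mul_pow, ← mul_pow]
    exact pow_dvd_pow _ (Nat.succ_le_of_lt i.isLt)
  have hrad : rad a b c ≤ P := by
    rw [rad_def]
    exact radical_le_of_dvd_pow hP0.ne' hdvd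
  have hR1 : (1 : ℝ) ≤ ((rad a b c : ℕ) : ℝ) := Literature.Barriers.ABC.one_le_rad_real a b c
  have hRP : ((rad a b c : ℕ) : ℝ) ≤ ((P : ℕ) : ℝ) := by exact_mod_cast hrad
  have hκ : κ ≤ max κ 1 + ε := (le_max_left _ _).trans (le_add_of_nonneg_right hε.le)
  have h0e : 0 ≤ max κ 1 + ε := by
    have : (1 : ℝ) ≤ max κ 1 := le_max_right _ _
    linarith
  have hlt : ((c : ℕ) : ℝ) < K * ((rad a b c : ℕ) : ℝ) ^ κ := hP a b c habc
  calc ((c : ℕ) : ℝ) < K * ((rad a b c : ℕ) : ℝ) ^ κ := hlt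
    _ ≤ K * ((rad a b c : ℕ) : ℝ) ^ (max κ 1 + ε) :=
        mul_le_mul_of_nonneg_left (Real.rpow_le_rpow_of_exponent_le hR1 hκ) hK.le
    _ ≤ K * ((P : ℕ) : ℝ) ^ (max κ 1 + ε) :=
        mul_le_mul_of_nonneg_left (Real.rpow_le_rpow (by positivity) hRP h0e) hK.le

/-! ## The composition (kernel-checked; concludes the crux BY NAME) -/

/-- **`TowerExponentWindow_of`** — the glue of the line (v2): lever (A3), dictionary (B3) and lift (C) give polynomial
abc with some exponent `κ` (`polyABC_of`); `tower_of_polyAbc` turns it into the tower inequality with exponent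
`A = max κ 1` at every level, and the level `n = ⌈3A⌉₊ + 1` lies in the window `3A < n`. -/
theorem TowerExponentWindow_of (hA : Registered.stub_depthWindow3)
    (hB : Registered.stub_flatBoundOfDepth3) (hC : Registered.stub_polyAbcOfFlatBound) :
    Summit.ABC.ABC.Theses.IneffectiveSubspace.TowerExponentWindow := by
  obtain ⟨κ, K, hK, hP⟩ := polyABC_of hA hB hC
  have hA1 : (1 : ℝ) ≤ max κ 1 := le_max_right _ _
  refine ⟨⌈3 * max κ 1⌉₊ + 1, by omega, max κ 1, by linarith, ?_, fun ε hε => ⟨K, hK, ?_⟩⟩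
  · have h1 : 3 * max κ 1 ≤ (⌈3 * max κ 1⌉₊ : ℝ) := Nat.le_ceil _
    push_cast
    linarith
  · intro x y z hpos hsum hcop
    exact tower_of_polyAbc hK hP _ hε x y z hpos hsum hcop

/-- Wiring check: the registered stubs feed `TowerExponentWindow_of` as stated (definitional unfolding only). -/
example : Summit.ABC.ABC.Theses.IneffectiveSubspace.TowerExponentWindow :=
  TowerExponentWindow_of stub_depthWindow3 stub_flatBoundOfDepth3 stub_polyAbcOfFlatBound

/-! ## Side theorems (proved): v1 ⟹ v2, and the refined dictionary B3 itself (lead; tree file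
`Theorems/IneffectiveSubspaceTowerExponentWindowFlatBoundOfDepth3.lean`) -/

/-- The planner's lever implies the refined one (`A₁ = A₂ = C₂ = C`; `2C < n` from `3C < n`). -/
theorem depthWindow3_of_binomialDepthWindow (h : BinomialDepthWindow) : DepthWindow3 := by
  obtain ⟨n, C, C', hC, h3, hD⟩ := h
  refine ⟨n, C, C, C, C', hC, hC, hC, by linarith, ?_⟩
  intro a₁ a₂ c₁ c₂ ha₁ ha₂ hc₁ hc₂ hcop hne d hd hdvd
  have := hD a₁ a₂ c₁ c₂ ha₁ ha₂ hc₁ hc₂ hcop hne d hd hdvd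
  linarith

/-- One application of the level-`n` depth inequality (coefficients `A₁, A₂, C₂ ≥ 0`) to a positive solution of
`uXⁿ + vYⁿ = wZⁿ` with `gcd(uXⁿ, vYⁿ) = 1`, at the data `(a₁,a₂,c₁,c₂) = (u, X, w, Z)` and the divisor `d = Yⁿ` of
`uXⁿ − wZⁿ = −vYⁿ`: `n·log Y ≤ A₁·log(uvw) + A₂·(log(wZⁿ)/n) + C₂·log Y + C'`
(`max(u,w) ≤ uvw`, `max(X,Z)ⁿ ≤ wZⁿ`, `rad(Yⁿ) ≤ Y`). [cite: Vojta2000ABC, §7] -/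
theorem FlatBoundOfDepth3.one_side {n : ℕ} (hn : n ≠ 0) {A₁ A₂ C₂ C' : ℝ} (hA₁ : 0 ≤ A₁) (hA₂ : 0 ≤ A₂)
    (hC₂ : 0 ≤ C₂)
    (hD : ∀ a₁ a₂ c₁ c₂ : ℕ, 0 < a₁ → 0 < a₂ → 0 < c₁ → 0 < c₂ → Nat.Coprime (a₁ * a₂) (c₁ * c₂) →
      a₁ * a₂ ^ n ≠ c₁ * c₂ ^ n → ∀ d : ℕ, 0 < d → (d : ℤ) ∣ ((a₁ * a₂ ^ n : ℕ) : ℤ) - ((c₁ * c₂ ^ n : ℕ) : ℤ) →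
      Real.log (d : ℝ) ≤ A₁ * Real.log ((max a₁ c₁ : ℕ) : ℝ) + A₂ * Real.log ((max a₂ c₂ : ℕ) : ℝ) +
        C₂ * Real.log ((UniqueFactorizationMonoid.radical d : ℕ) : ℝ) + C')
    {u v w X Y Z : ℕ} (hu : 0 < u) (hv : 0 < v) (hw : 0 < w) (hX : 0 < X) (hY : 0 < Y) (hZ : 0 < Z)
    (heq : u * X ^ n + v * Y ^ n = w * Z ^ n) (hcop : Nat.Coprime (u * X ^ n) (v * Y ^ n)) :
    (n : ℝ) * Real.log (Y : ℝ) ≤ A₁ * Real.log ((u * v * w : ℕ) : ℝ) +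
      A₂ * (Real.log ((w * Z ^ n : ℕ) : ℝ) / n) + C₂ * Real.log (Y : ℝ) + C' := by
  -- admissibility of the data `(u, X, w, Z)`, `d = Yⁿ`
  have hcop1 : Nat.Coprime (u * X ^ n) (w * Z ^ n) := by
    rw [← heq]; exact Nat.coprime_self_add_right.mpr hcop
  have hcop2 : Nat.Coprime (u * X) (w * Z) :=
    Nat.Coprime.coprime_dvd_left (mul_dvd_mul_left u (dvd_pow_self X hn))
      (Nat.Coprime.coprime_dvd_right (mul_dvd_mul_left w (dvd_pow_self Z hn)) hcop1)
  have hne : u * X ^ n ≠ w * Z ^ n := by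
    have : 0 < v * Y ^ n := by positivity
    omega
  have hdvd : ((Y ^ n : ℕ) : ℤ) ∣ ((u * X ^ n : ℕ) : ℤ) - ((w * Z ^ n : ℕ) : ℤ) := by
    refine ⟨-(v : ℤ), ?_⟩
    have h := congrArg (Nat.cast : ℕ → ℤ) heq
    push_cast at h ⊢
    linear_combination h
  have hYn : 0 < Y ^ n := by positivity
  have key := hD u X w Z hu hX hw hZ hcop2 hne (Y ^ n) hYn hdvd
  -- the three bounds
  have huR : (0 : ℝ) < u := by exact_mod_cast hu
  have hvR : (0 : ℝ) < v := by exact_mod_cast hv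
  have hwR : (0 : ℝ) < w := by exact_mod_cast hw
  have hXR : (0 : ℝ) < X := by exact_mod_cast hX
  have hYR : (0 : ℝ) < Y := by exact_mod_cast hY
  have hZR : (0 : ℝ) < Z := by exact_mod_cast hZ
  have hnR : (0 : ℝ) < n := by exact_mod_cast Nat.pos_of_ne_zero hn
  have hb1 : Real.log ((max u w : ℕ) : ℝ) ≤ Real.log ((u * v * w : ℕ) : ℝ) := by
    have h1 : max u w ≤ u * v * w := by
      refine max_le ?_ ?_
      · calc u = u * 1 * 1 := by ring
          _ ≤ u * v * w := Nat.mul_le_mul (Nat.mul_le_mul le_rfl hv) hw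
      · calc w = 1 * 1 * w := by ring
          _ ≤ u * v * w := Nat.mul_le_mul (Nat.mul_le_mul hu hv) le_rfl
    exact Real.log_le_log (by exact_mod_cast lt_max_of_lt_left hu) (by exact_mod_cast h1)
  have hb2 : Real.log ((max X Z : ℕ) : ℝ) ≤ Real.log ((w * Z ^ n : ℕ) : ℝ) / n := by
    rw [le_div_iff₀ hnR, mul_comm, ← Real.log_pow]
    have h1 : (max X Z) ^ n ≤ w * Z ^ n := by
      rcases le_total X Z with hle | hle
      · rw [max_eq_right hle]
        exact Nat.le_mul_of_pos_left _ hw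
      · rw [max_eq_left hle]
        calc X ^ n = 1 * X ^ n := (one_mul _).symm
          _ ≤ u * X ^ n := Nat.mul_le_mul_right _ hu
          _ ≤ w * Z ^ n := by rw [← heq]; exact Nat.le_add_right _ _
    have h2 : ((max X Z : ℕ) : ℝ) ^ n ≤ ((w * Z ^ n : ℕ) : ℝ) := by exact_mod_cast h1
    exact Real.log_le_log (by positivity) h2
  have hb3 : Real.log ((UniqueFactorizationMonoid.radical (Y ^ n) : ℕ) : ℝ) ≤ Real.log (Y : ℝ) := by
    have h1 : UniqueFactorizationMonoid.radical (Y ^ n) ≤ Y := radical_le_of_dvd_pow (n := n) hY.ne' dvd_rfl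
    exact Real.log_le_log (by exact_mod_cast Nat.radical_pos _) (by exact_mod_cast h1)
  have hlogYn : Real.log (((Y ^ n : ℕ) : ℕ) : ℝ) = n * Real.log (Y : ℝ) := by
    push_cast; rw [Real.log_pow]
  rw [hlogYn] at key
  have e1 := mul_le_mul_of_nonneg_left hb1 hA₁
  have e2 := mul_le_mul_of_nonneg_left hb2 hA₂
  have e3 := mul_le_mul_of_nonneg_left hb3 hC₂
  linarith

/-- **Refined dictionary** (`D = 0` flat bound from the depth inequality with separate coefficients).  For
`0 ≤ A₁, A₂, C₂` with `A₂ + C₂ < n`: if every positive divisor `d` of `a₁a₂ⁿ − c₁c₂ⁿ` (positive data,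
`gcd(a₁a₂, c₁c₂) = 1`, `a₁a₂ⁿ ≠ c₁c₂ⁿ`) satisfies `log d ≤ A₁·log max(a₁,c₁) + A₂·log max(a₂,c₂) + C₂·log rad d + C'`,
then `wZⁿ ≤ K·(uvw)^κ` on positive solutions of `uXⁿ + vYⁿ = wZⁿ` with `gcd(uXⁿ, vYⁿ) = 1`
(`κ = (n − C₂ + nA₁)/(n − A₂ − C₂)`).  Proof: `one_side` for `Y` and, by symmetry, for `X` gives
`(n − C₂)·M ≤ A₁L + A₂ℓ/n + C'` for `M = max(log X, log Y)`, `L = log(uvw)`, `ℓ = log(wZⁿ)`; and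
`wZⁿ ≤ 2·max(uXⁿ, vYⁿ) ≤ 2uvw·e^{nM}` gives `ℓ ≤ log 2 + L + nM`; eliminate `M`. The registered stub
`stub_flatBoundOfDepth` is the case `A₁ = A₂ = C₂ = C` (window `2C < n`, implied by its `3C < n`).
[cite: Vojta2000ABC, §7] -/
theorem flatBound_of_depthIneq3 : ∀ n : ℕ, ∀ A₁ A₂ C₂ C' : ℝ, 0 ≤ A₁ → 0 ≤ A₂ → 0 ≤ C₂ → A₂ + C₂ < n →
    (∀ a₁ a₂ c₁ c₂ : ℕ, 0 < a₁ → 0 < a₂ → 0 < c₁ → 0 < c₂ → Nat.Coprime (a₁ * a₂) (c₁ * c₂) →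
      a₁ * a₂ ^ n ≠ c₁ * c₂ ^ n → ∀ d : ℕ, 0 < d → (d : ℤ) ∣ ((a₁ * a₂ ^ n : ℕ) : ℤ) - ((c₁ * c₂ ^ n : ℕ) : ℤ) →
      Real.log (d : ℝ) ≤ A₁ * Real.log ((max a₁ c₁ : ℕ) : ℝ) + A₂ * Real.log ((max a₂ c₂ : ℕ) : ℝ) +
        C₂ * Real.log ((UniqueFactorizationMonoid.radical d : ℕ) : ℝ) + C') →
    ∃ κ K : ℝ, ∀ u v w X Y Z : ℕ, 0 < u → 0 < v → 0 < w → 0 < X → 0 < Y → 0 < Z →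
      u * X ^ n + v * Y ^ n = w * Z ^ n → Nat.Coprime (u * X ^ n) (v * Y ^ n) →
      ((w * Z ^ n : ℕ) : ℝ) ≤ K * ((u * v * w : ℕ) : ℝ) ^ κ := by
  intro n A₁ A₂ C₂ C' hA₁ hA₂ hC₂ hwin hD
  have hnR0 : (0 : ℝ) < n := by linarith
  have hn : n ≠ 0 := by rintro rfl; simp at hnR0
  set δ : ℝ := (n : ℝ) - A₂ - C₂ with hδ
  have hδ0 : 0 < δ := by rw [hδ]; linarith
  set κ : ℝ := ((n : ℝ) - C₂ + n * A₁) / δ with hκ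
  set c₀ : ℝ := (((n : ℝ) - C₂) * Real.log 2 + n * C') / δ with hc₀
  refine ⟨κ, Real.exp c₀, ?_⟩
  intro u v w X Y Z hu hv hw hX hY hZ heq hcop
  have huR : (0 : ℝ) < u := by exact_mod_cast hu
  have hvR : (0 : ℝ) < v := by exact_mod_cast hv
  have hwR : (0 : ℝ) < w := by exact_mod_cast hw
  have hXR : (0 : ℝ) < X := by exact_mod_cast hX
  have hYR : (0 : ℝ) < Y := by exact_mod_cast hY
  have hZR : (0 : ℝ) < Z := by exact_mod_cast hZ
  set L : ℝ := Real.log ((u * v * w : ℕ) : ℝ) with hL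
  set ℓ : ℝ := Real.log ((w * Z ^ n : ℕ) : ℝ) with hℓ
  have hP0 : (0 : ℝ) < ((u * v * w : ℕ) : ℝ) := by positivity
  have hc0 : (0 : ℝ) < ((w * Z ^ n : ℕ) : ℝ) := by positivity
  -- (1), (2): the two applications
  have hYside := FlatBoundOfDepth3.one_side hn hA₁ hA₂ hC₂ hD hu hv hw hX hY hZ heq hcop
  have hXside : (n : ℝ) * Real.log (X : ℝ) ≤ A₁ * L + A₂ * (ℓ / n) + C₂ * Real.log (X : ℝ) + C' := by
    have h := FlatBoundOfDepth3.one_side hn hA₁ hA₂ hC₂ hD hv hu hw hY hX hZ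
      (by rw [← heq]; ring) hcop.symm
    have e : ((v * u * w : ℕ) : ℝ) = ((u * v * w : ℕ) : ℝ) := by push_cast; ring
    rwa [e] at h
  -- (3): the maximum `M`
  set M : ℝ := max (Real.log (X : ℝ)) (Real.log (Y : ℝ)) with hM
  have hMbound : ((n : ℝ) - C₂) * M ≤ A₁ * L + A₂ * (ℓ / n) + C' := by
    rcases le_total (Real.log (X : ℝ)) (Real.log (Y : ℝ)) with hle | hle
    · rw [hM, max_eq_right hle]; linarith
    · rw [hM, max_eq_left hle]; linarith
  -- (4): `wZⁿ ≤ 2·max(uXⁿ, vYⁿ) ≤ 2·uvw·exp(n M)`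
  have hℓbound : ℓ ≤ Real.log 2 + L + n * M := by
    have hXM : Real.log (X : ℝ) ≤ M := le_max_left _ _
    have hYM : Real.log (Y : ℝ) ≤ M := le_max_right _ _
    have hXe : (X : ℝ) ^ n ≤ Real.exp (n * M) := by
      have : (X : ℝ) ^ n = Real.exp (n * Real.log (X : ℝ)) := by
        rw [← Real.log_pow, Real.exp_log (by positivity)]
      rw [this]; exact Real.exp_le_exp.mpr (by nlinarith [hnR0.le])
    have hYe : (Y : ℝ) ^ n ≤ Real.exp (n * M) := by
      have : (Y : ℝ) ^ n = Real.exp (n * Real.log (Y : ℝ)) := by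
        rw [← Real.log_pow, Real.exp_log (by positivity)]
      rw [this]; exact Real.exp_le_exp.mpr (by nlinarith [hnR0.le])
    have hE : 0 < Real.exp (n * M) := Real.exp_pos _
    have h1 : ((w * Z ^ n : ℕ) : ℝ) ≤ 2 * ((u * v * w : ℕ) : ℝ) * Real.exp (n * M) := by
      have heqR : ((w * Z ^ n : ℕ) : ℝ) = (u : ℝ) * (X : ℝ) ^ n + (v : ℝ) * (Y : ℝ) ^ n := by
        rw [← heq]; push_cast; ring
      rw [heqR]; push_cast
      have hu1 : (1 : ℝ) ≤ u := by exact_mod_cast hu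
      have hv1 : (1 : ℝ) ≤ v := by exact_mod_cast hv
      have hw1 : (1 : ℝ) ≤ w := by exact_mod_cast hw
      have t1 : (u : ℝ) * (X : ℝ) ^ n ≤ (u : ℝ) * v * w * Real.exp (n * M) := by
        calc (u : ℝ) * (X : ℝ) ^ n ≤ (u : ℝ) * Real.exp (n * M) := mul_le_mul_of_nonneg_left hXe huR.le
          _ = (u : ℝ) * 1 * 1 * Real.exp (n * M) := by ring
          _ ≤ (u : ℝ) * v * w * Real.exp (n * M) := by gcongr
      have t2 : (v : ℝ) * (Y : ℝ) ^ n ≤ (u : ℝ) * v * w * Real.exp (n * M) := by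
        calc (v : ℝ) * (Y : ℝ) ^ n ≤ (v : ℝ) * Real.exp (n * M) := mul_le_mul_of_nonneg_left hYe hvR.le
          _ = 1 * (v : ℝ) * 1 * Real.exp (n * M) := by ring
          _ ≤ (u : ℝ) * v * w * Real.exp (n * M) := by gcongr
      linarith
    have h2 := Real.log_le_log hc0 h1
    rw [Real.log_mul (by positivity) hE.ne', Real.log_mul (by norm_num) hP0.ne', Real.log_exp] at h2
    simpa [hℓ, hL] using h2
  -- (5): eliminate `M`: `δ·ℓ ≤ (n − C₂ + nA₁)·L + (n − C₂)·log 2 + n·C'`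
  have hnC : 0 ≤ (n : ℝ) - C₂ := by linarith
  have helim : δ * ℓ ≤ ((n : ℝ) - C₂ + n * A₁) * L + ((n : ℝ) - C₂) * Real.log 2 + n * C' := by
    have h1 := mul_le_mul_of_nonneg_left hℓbound hnC
    have h2 := mul_le_mul_of_nonneg_left hMbound hnR0.le
    have e : (n : ℝ) * (A₁ * L + A₂ * (ℓ / n) + C') = n * A₁ * L + A₂ * ℓ + n * C' := by
      field_simp
    rw [e] at h2
    rw [hδ]
    nlinarith
  have hℓle : ℓ ≤ κ * L + c₀ := by
    rw [hκ, hc₀, div_mul_eq_mul_div, ← add_div, le_div_iff₀ hδ0]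
    linarith
  -- (6): exponentiate
  have hlhs : ((w * Z ^ n : ℕ) : ℝ) = Real.exp ℓ := by rw [hℓ, Real.exp_log hc0]
  have hrhs : Real.exp c₀ * ((u * v * w : ℕ) : ℝ) ^ κ = Real.exp (κ * L + c₀) := by
    rw [Real.rpow_def_of_pos hP0, ← Real.exp_add, hL]; ring_nf
  rw [hlhs, hrhs]
  exact Real.exp_le_exp.mpr hℓle


/-- The refined dictionary, as the named statement. -/
theorem flatBoundOfDepth3_proved : FlatBoundOfDepth3 := flatBound_of_depthIneq3

/-! ## Side theorems (proved): PolyABC ⟹ the refined lever — so lever v2 ⟺ PolyABC ⟺ crux -/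

/-- Core of `depthIneq3_of_polyAbc`, orientation `c₁c₂ⁿ < a₁a₂ⁿ`: polynomial abc with exponent `k ≥ 1` and constant
`K > 0` bounds every divisor `d` of `a₁a₂ⁿ − c₁c₂ⁿ` (coprime positive data) by
`log d ≤ (3 − 1/k)·log max(a₁,c₁) + (2 + n(1 − 1/k))·log max(a₂,c₂) + log rad d + (log K)/k`.
Proof: `(P − Q, Q, P)` is an abc triple (`P = a₁a₂ⁿ`, `Q = c₁c₂ⁿ`), `rad((P−Q)QP) ≤ rad d·(P−Q)/d·c₁c₂·a₁a₂`,
`(P − Q)/d ≤ P/d`, `log P ≤ h₁ + n h₂`. [folklore] -/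
theorem DepthWindowRefined.core {k K : ℝ} (hk : 1 ≤ k) (hK : 0 < K) {n : ℕ}
    (hABC : ∀ a b c : ℕ, IsABCTriple a b c → (c : ℝ) < K * ((rad a b c : ℕ) : ℝ) ^ k)
    {a₁ a₂ c₁ c₂ d : ℕ} (ha₁ : 0 < a₁) (ha₂ : 0 < a₂) (hc₁ : 0 < c₁) (hc₂ : 0 < c₂)
    (hcop : Nat.Coprime (a₁ * a₂) (c₁ * c₂)) (hlt : c₁ * c₂ ^ n < a₁ * a₂ ^ n) (hd : 0 < d)
    (hdvd : (d : ℤ) ∣ ((a₁ * a₂ ^ n : ℕ) : ℤ) - ((c₁ * c₂ ^ n : ℕ) : ℤ)) :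
    Real.log (d : ℝ) ≤ (3 - 1 / k) * Real.log ((max a₁ c₁ : ℕ) : ℝ) +
      (2 + n * (1 - 1 / k)) * Real.log ((max a₂ c₂ : ℕ) : ℝ) +
      1 * Real.log ((UniqueFactorizationMonoid.radical d : ℕ) : ℝ) + Real.log K / k := by
  set P : ℕ := a₁ * a₂ ^ n with hPdef
  set Q : ℕ := c₁ * c₂ ^ n with hQdef
  have hP0 : 0 < P := by positivity
  have hQ0 : 0 < Q := by positivity
  -- `d ∣ P - Q` in `ℕ`
  obtain ⟨e, he⟩ : d ∣ P - Q := by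
    have h1 : ((P - Q : ℕ) : ℤ) = (P : ℤ) - (Q : ℤ) := Nat.cast_sub hlt.le
    have h2 : (d : ℤ) ∣ ((P - Q : ℕ) : ℤ) := by rw [h1]; exact hdvd
    exact Int.natCast_dvd_natCast.mp h2
  have hD0 : 0 < P - Q := Nat.sub_pos_of_lt hlt
  have he0 : 0 < e := by
    rcases Nat.eq_zero_or_pos e with h | h
    · rw [h, mul_zero] at he; omega
    · exact h
  -- `(P - Q, Q, P)` is an abc triple
  have hPd : P ∣ (a₁ * a₂) ^ n.succ := by
    rw [mul_pow]; exact mul_dvd_mul (dvd_pow_self a₁ (Nat.succ_ne_zero n)) (pow_dvd_pow a₂ n.le_succ)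
  have hQd : Q ∣ (c₁ * c₂) ^ n.succ := by
    rw [mul_pow]; exact mul_dvd_mul (dvd_pow_self c₁ (Nat.succ_ne_zero n)) (pow_dvd_pow c₂ n.le_succ)
  have hPQ : Nat.Coprime P Q :=
    Nat.Coprime.coprime_dvd_left hPd (Nat.Coprime.coprime_dvd_right hQd (Nat.Coprime.pow _ _ hcop))
  have hDQ : Nat.Coprime (P - Q) Q := (Nat.coprime_sub_self_left hlt.le).mpr hPQ
  have habc3 : IsABCTriple (P - Q) Q P := ⟨hD0, hQ0, Nat.sub_add_cancel hlt.le, hDQ⟩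
  have hmain := hABC _ _ _ habc3
  -- the radical bound in `ℕ`: `rad((P-Q)·Q·P) ≤ rad d · e · c₁c₂ · a₁a₂`
  have hDrad : UniqueFactorizationMonoid.radical (P - Q) ≤ UniqueFactorizationMonoid.radical d * e := by
    rw [he]
    calc UniqueFactorizationMonoid.radical (d * e)
        ≤ UniqueFactorizationMonoid.radical d * UniqueFactorizationMonoid.radical e :=
          Nat.le_of_dvd (mul_pos (Nat.radical_pos _) (Nat.radical_pos _))
            UniqueFactorizationMonoid.radical_mul_dvd
      _ ≤ UniqueFactorizationMonoid.radical d * e :=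
          Nat.mul_le_mul_left _ (Nat.radical_le_self_iff.mpr he0.ne')
  have hQrad : UniqueFactorizationMonoid.radical Q ≤ c₁ * c₂ :=
    radical_le_of_dvd_pow (n := n.succ) (by positivity) hQd
  have hPrad : UniqueFactorizationMonoid.radical P ≤ a₁ * a₂ :=
    radical_le_of_dvd_pow (n := n.succ) (by positivity) hPd
  have hradN : rad (P - Q) Q P ≤ UniqueFactorizationMonoid.radical d * e * (c₁ * c₂) * (a₁ * a₂) := by
    rw [rad_def]
    exact (radical_mul_three_le _ _ _).trans (Nat.mul_le_mul (Nat.mul_le_mul hDrad hQrad) hPrad)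
  -- real-side facts
  set R : ℝ := ((rad (P - Q) Q P : ℕ) : ℝ) with hRdef
  have hR1 : (1 : ℝ) ≤ R := Literature.Barriers.ABC.one_le_rad_real _ _ _
  have hR0 : 0 < R := by linarith
  have hPR : (0 : ℝ) < (P : ℝ) := by exact_mod_cast hP0
  have hdR : (0 : ℝ) < (d : ℝ) := by exact_mod_cast hd
  have heR : (0 : ℝ) < (e : ℝ) := by exact_mod_cast he0
  have ha₁R : (0 : ℝ) < (a₁ : ℝ) := by exact_mod_cast ha₁
  have ha₂R : (0 : ℝ) < (a₂ : ℝ) := by exact_mod_cast ha₂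
  have hc₁R : (0 : ℝ) < (c₁ : ℝ) := by exact_mod_cast hc₁
  have hc₂R : (0 : ℝ) < (c₂ : ℝ) := by exact_mod_cast hc₂
  have hrdR : (0 : ℝ) < ((UniqueFactorizationMonoid.radical d : ℕ) : ℝ) := by
    exact_mod_cast Nat.radical_pos d
  have hk0 : 0 < k := by linarith
  -- (1) abc, logarithmically
  have h1 : Real.log (P : ℝ) < Real.log K + k * Real.log R := by
    have h := Real.log_lt_log hPR hmain
    rwa [Real.log_mul hK.ne' (Real.rpow_pos_of_pos hR0 _).ne', Real.log_rpow hR0] at h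
  -- (2) the radical bound, logarithmically
  have h2 : Real.log R ≤ Real.log ((UniqueFactorizationMonoid.radical d : ℕ) : ℝ) + Real.log (e : ℝ) +
      (Real.log (c₁ : ℝ) + Real.log (c₂ : ℝ)) + (Real.log (a₁ : ℝ) + Real.log (a₂ : ℝ)) := by
    have hcast : R ≤ ((UniqueFactorizationMonoid.radical d : ℕ) : ℝ) * (e : ℝ) * ((c₁ : ℝ) * (c₂ : ℝ)) *
        ((a₁ : ℝ) * (a₂ : ℝ)) := by
      rw [hRdef]; exact_mod_cast hradN
    have h := Real.log_le_log hR0 hcast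
    rwa [Real.log_mul (mul_pos (mul_pos hrdR heR) (mul_pos hc₁R hc₂R)).ne' (mul_pos ha₁R ha₂R).ne',
      Real.log_mul (mul_pos hrdR heR).ne' (mul_pos hc₁R hc₂R).ne', Real.log_mul hrdR.ne' heR.ne',
      Real.log_mul hc₁R.ne' hc₂R.ne', Real.log_mul ha₁R.ne' ha₂R.ne'] at h
  -- (3) `d · e = P - Q ≤ P`
  have h3 : Real.log (d : ℝ) + Real.log (e : ℝ) ≤ Real.log (P : ℝ) := by
    have hDP : ((P - Q : ℕ) : ℝ) ≤ (P : ℝ) := by exact_mod_cast Nat.sub_le P Q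
    have hDe : ((P - Q : ℕ) : ℝ) = (d : ℝ) * (e : ℝ) := by rw [he]; push_cast; ring
    have h := Real.log_le_log (by rw [hDe]; positivity) hDP
    rwa [hDe, Real.log_mul hdR.ne' heR.ne'] at h
  -- (4) heights
  have h4 : Real.log (P : ℝ) = Real.log (a₁ : ℝ) + n * Real.log (a₂ : ℝ) := by
    have : (P : ℝ) = (a₁ : ℝ) * (a₂ : ℝ) ^ n := by rw [hPdef]; push_cast; ring
    rw [this, Real.log_mul ha₁R.ne' (pow_pos ha₂R n).ne', Real.log_pow]
  have h5a : Real.log (a₁ : ℝ) ≤ Real.log ((max a₁ c₁ : ℕ) : ℝ) :=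
    Real.log_le_log ha₁R (by exact_mod_cast le_max_left a₁ c₁)
  have h5c : Real.log (c₁ : ℝ) ≤ Real.log ((max a₁ c₁ : ℕ) : ℝ) :=
    Real.log_le_log hc₁R (by exact_mod_cast le_max_right a₁ c₁)
  have h6a : Real.log (a₂ : ℝ) ≤ Real.log ((max a₂ c₂ : ℕ) : ℝ) :=
    Real.log_le_log ha₂R (by exact_mod_cast le_max_left a₂ c₂)
  have h6c : Real.log (c₂ : ℝ) ≤ Real.log ((max a₂ c₂ : ℕ) : ℝ) :=
    Real.log_le_log hc₂R (by exact_mod_cast le_max_right a₂ c₂)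
  have h7 : 0 ≤ Real.log ((max a₁ c₁ : ℕ) : ℝ) :=
    Real.log_nonneg (by exact_mod_cast (le_max_left a₁ c₁).trans' ha₁)
  have h8 : 0 ≤ Real.log ((max a₂ c₂ : ℕ) : ℝ) :=
    Real.log_nonneg (by exact_mod_cast (le_max_left a₂ c₂).trans' ha₂)
  have h10 : 0 ≤ Real.log (a₁ : ℝ) := Real.log_nonneg (by exact_mod_cast ha₁)
  have h11 : 0 ≤ Real.log (a₂ : ℝ) := Real.log_nonneg (by exact_mod_cast ha₂)
  have hn0 : (0 : ℝ) ≤ n := Nat.cast_nonneg n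
  -- combine: k·log d < log K + k·log rad d + (k − 1)·log P + k(log a₁ + log c₁) + k(log a₂ + log c₂)
  have hcomb : k * Real.log (d : ℝ) ≤ Real.log K + k * Real.log ((UniqueFactorizationMonoid.radical d : ℕ) : ℝ) +
      (k - 1) * (Real.log ((max a₁ c₁ : ℕ) : ℝ) + n * Real.log ((max a₂ c₂ : ℕ) : ℝ)) +
      2 * k * Real.log ((max a₁ c₁ : ℕ) : ℝ) + 2 * k * Real.log ((max a₂ c₂ : ℕ) : ℝ) := by
    have hk1 : 0 ≤ k - 1 := by linarith
    have hPle : Real.log (P : ℝ) ≤ Real.log ((max a₁ c₁ : ℕ) : ℝ) + n * Real.log ((max a₂ c₂ : ℕ) : ℝ) := by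
      rw [h4]; nlinarith [mul_le_mul_of_nonneg_left h6a hn0]
    nlinarith [mul_le_mul_of_nonneg_left h2 hk0.le, mul_le_mul_of_nonneg_left hPle hk1,
      mul_le_mul_of_nonneg_left h5a hk0.le, mul_le_mul_of_nonneg_left h5c hk0.le,
      mul_le_mul_of_nonneg_left h6a hk0.le, mul_le_mul_of_nonneg_left h6c hk0.le]
  -- divide by k
  have hgoal : Real.log (d : ℝ) ≤ Real.log K / k + Real.log ((UniqueFactorizationMonoid.radical d : ℕ) : ℝ) +
      (3 - 1 / k) * Real.log ((max a₁ c₁ : ℕ) : ℝ) + (2 + n * (1 - 1 / k)) * Real.log ((max a₂ c₂ : ℕ) : ℝ) := by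
    rw [← sub_nonneg] at hcomb ⊢
    have e : Real.log K / k + Real.log ((UniqueFactorizationMonoid.radical d : ℕ) : ℝ) +
        (3 - 1 / k) * Real.log ((max a₁ c₁ : ℕ) : ℝ) + (2 + n * (1 - 1 / k)) * Real.log ((max a₂ c₂ : ℕ) : ℝ) -
        Real.log (d : ℝ) = (1 / k) * (Real.log K + k * Real.log ((UniqueFactorizationMonoid.radical d : ℕ) : ℝ) +
      (k - 1) * (Real.log ((max a₁ c₁ : ℕ) : ℝ) + n * Real.log ((max a₂ c₂ : ℕ) : ℝ)) +
      2 * k * Real.log ((max a₁ c₁ : ℕ) : ℝ) + 2 * k * Real.log ((max a₂ c₂ : ℕ) : ℝ) - k * Real.log (d : ℝ)) := by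
      field_simp; ring
    rw [e]; positivity
  linarith

/-- **Polynomial abc ⟹ the refined depth inequality at every level.**  If `c < K·rad(abc)^κ` on abc triples
(`K > 0`), then with `k = max κ 1`, for every `n` and all positive `a₁ a₂ c₁ c₂` with `gcd(a₁a₂, c₁c₂) = 1`,
`a₁a₂ⁿ ≠ c₁c₂ⁿ`, every positive divisor `d` of `a₁a₂ⁿ − c₁c₂ⁿ` (in `ℤ`) satisfies
`log d ≤ (3 − 1/k)·log max(a₁,c₁) + (2 + n(1 − 1/k))·log max(a₂,c₂) + 1·log rad d + (log K)/k`.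
The `h₂`-coefficient plus the `log rad d`-coefficient is `3 + n(1 − 1/k) < n` iff `n > 3k`. [folklore] -/
theorem depthIneq3_of_polyAbc {κ K : ℝ} (hK : 0 < K)
    (hABC : ∀ a b c : ℕ, IsABCTriple a b c → (c : ℝ) < K * ((rad a b c : ℕ) : ℝ) ^ κ) (n : ℕ) :
    ∀ a₁ a₂ c₁ c₂ : ℕ, 0 < a₁ → 0 < a₂ → 0 < c₁ → 0 < c₂ → Nat.Coprime (a₁ * a₂) (c₁ * c₂) →
      a₁ * a₂ ^ n ≠ c₁ * c₂ ^ n → ∀ d : ℕ, 0 < d → (d : ℤ) ∣ ((a₁ * a₂ ^ n : ℕ) : ℤ) - ((c₁ * c₂ ^ n : ℕ) : ℤ) →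
      Real.log (d : ℝ) ≤ (3 - 1 / max κ 1) * Real.log ((max a₁ c₁ : ℕ) : ℝ) +
        (2 + n * (1 - 1 / max κ 1)) * Real.log ((max a₂ c₂ : ℕ) : ℝ) +
        1 * Real.log ((UniqueFactorizationMonoid.radical d : ℕ) : ℝ) + Real.log K / max κ 1 := by
  -- upgrade the exponent to `k = max κ 1 ≥ 1` (`rad ≥ 1`)
  have hABC' : ∀ a b c : ℕ, IsABCTriple a b c → (c : ℝ) < K * ((rad a b c : ℕ) : ℝ) ^ (max κ 1) := by
    intro a b c h
    have hR1 : (1 : ℝ) ≤ ((rad a b c : ℕ) : ℝ) := Literature.Barriers.ABC.one_le_rad_real a b c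
    exact (hABC a b c h).trans_le
      (mul_le_mul_of_nonneg_left (Real.rpow_le_rpow_of_exponent_le hR1 (le_max_left _ _)) hK.le)
  intro a₁ a₂ c₁ c₂ ha₁ ha₂ hc₁ hc₂ hcop hne d hd hdvd
  rcases Nat.lt_or_gt_of_ne hne with hlt | hlt
  · -- `a₁a₂ⁿ < c₁c₂ⁿ`: exchange the roles of `a` and `c`
    have h := DepthWindowRefined.core (le_max_right κ 1) hK hABC' hc₁ hc₂ ha₁ ha₂ hcop.symm hlt hd
      (dvd_sub_comm.mp hdvd)
    rwa [max_comm c₁ a₁, max_comm c₂ a₂] at h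
  · exact DepthWindowRefined.core (le_max_right κ 1) hK hABC' ha₁ ha₂ hc₁ hc₂ hcop hlt hd hdvd

/-- **Polynomial abc ⟹ the refined lever** (the converse half of "lever ⟺ crux"): from `c < K·rad(abc)^κ` one gets
a level `n` (namely `⌊3·max κ 1⌋₊ + 1`) and nonnegative coefficients `A₁, A₂, C₂` with `A₂ + C₂ < n` such that the
refined depth inequality holds at level `n`. [folklore] -/
theorem depthWindow3_of_polyAbc
    (h : ∃ κ K : ℝ, 0 < K ∧ ∀ a b c : ℕ, IsABCTriple a b c → (c : ℝ) < K * ((rad a b c : ℕ) : ℝ) ^ κ) :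
    ∃ n : ℕ, ∃ A₁ A₂ C₂ C' : ℝ, 0 ≤ A₁ ∧ 0 ≤ A₂ ∧ 0 ≤ C₂ ∧ A₂ + C₂ < n ∧
      ∀ a₁ a₂ c₁ c₂ : ℕ, 0 < a₁ → 0 < a₂ → 0 < c₁ → 0 < c₂ → Nat.Coprime (a₁ * a₂) (c₁ * c₂) →
      a₁ * a₂ ^ n ≠ c₁ * c₂ ^ n → ∀ d : ℕ, 0 < d → (d : ℤ) ∣ ((a₁ * a₂ ^ n : ℕ) : ℤ) - ((c₁ * c₂ ^ n : ℕ) : ℤ) →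
      Real.log (d : ℝ) ≤ A₁ * Real.log ((max a₁ c₁ : ℕ) : ℝ) + A₂ * Real.log ((max a₂ c₂ : ℕ) : ℝ) +
        C₂ * Real.log ((UniqueFactorizationMonoid.radical d : ℕ) : ℝ) + C' := by
  obtain ⟨κ, K, hK, hABC⟩ := h
  set k : ℝ := max κ 1 with hk
  have hk1 : 1 ≤ k := le_max_right _ _
  have hk0 : 0 < k := by linarith
  refine ⟨⌊3 * k⌋₊ + 1, 3 - 1 / k, 2 + (⌊3 * k⌋₊ + 1 : ℕ) * (1 - 1 / k), 1, Real.log K / k, ?_, ?_, zero_le_one, ?_,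
    depthIneq3_of_polyAbc hK hABC _⟩
  · have : 1 / k ≤ 1 := by rw [div_le_one hk0]; exact hk1
    linarith
  · have h1 : 0 ≤ 1 - 1 / k := by rw [sub_nonneg, div_le_one hk0]; exact hk1
    positivity
  · -- window: `3 + n(1 − 1/k) < n` iff `3k < n`, and `n = ⌊3k⌋₊ + 1 > 3k`
    have hn : 3 * k < (⌊3 * k⌋₊ + 1 : ℕ) := by push_cast; exact Nat.lt_floor_add_one (3 * k)
    set N : ℝ := ((⌊3 * k⌋₊ + 1 : ℕ) : ℝ) with hN
    have e : 2 + N * (1 - 1 / k) + 1 = N - (N - 3 * k) / k := by field_simp; ring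
    rw [e]
    have : 0 < (N - 3 * k) / k := div_pos (by linarith) hk0
    linarith


/-- **Lever v2 ⟺ polynomial abc**, modulo the lift stub C (the dictionary B3 is proved above). -/
theorem depthWindow3_iff_polyAbc (hC : PolyAbcOfFlatBound) : DepthWindow3 ↔ PolyABC :=
  ⟨fun hA => polyABC_of hA flatBoundOfDepth3_proved hC, fun hP => depthWindow3_of_polyAbc hP⟩

/-! ## Side theorem (proved): the card's uniform Ξ-statement implies the lever — "the constant is traded for the
level". Not used by the skeleton; it records in checked form why ANY constant in Baker's conjectured two-log
Ξ-inequality suffices. -/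

/-- **The uniform binomial Ξ-inequality** `BinomialXi C C'` (the card's K1; Baker 1998 / Baker–Wüstholz §3.7 (i)+(ii)
restricted to the binomial two-logarithm forms `log(a₁/c₁) + k·log(a₂/c₂)`, with the proved `log`-dependence on
the coefficient `k` kept as a factor `log(k+2)`): for every exponent `k` and every divisor `d` of `a₁a₂ᵏ − c₁c₂ᵏ`
(coprime positive data), `log d ≤ C·(log max(a₁,c₁) + log max(a₂,c₂) + log rad d)·log(k+2) + C'`. STRONGER than the
lever: at `(a₁,a₂,c₁,c₂) = (1,2,1,1)` it says every divisor `d` of `2ᵏ − 1` has `d ≤ K·(2·rad d)^(C·log(k+2))`, a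
Wieferich/power-orbit statement the line never uses; kept only as motivation/calibration (kit jobs j007300/j007304 of
the ideator, j007622 of the triager; results attach to the evidence of stmt-ABC-1647).
[BakerWustholz2007 §3.7 p. 70; Baker1998] -/
def BinomialXi (C C' : ℝ) : Prop :=
  ∀ k : ℕ, ∀ a₁ a₂ c₁ c₂ : ℕ, 0 < a₁ → 0 < a₂ → 0 < c₁ → 0 < c₂ → Nat.Coprime (a₁ * a₂) (c₁ * c₂) →
    a₁ * a₂ ^ k ≠ c₁ * c₂ ^ k →
    ∀ d : ℕ, 0 < d → (d : ℤ) ∣ ((a₁ * a₂ ^ k : ℕ) : ℤ) - ((c₁ * c₂ ^ k : ℕ) : ℤ) →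
      Real.log (d : ℝ) ≤ C * (Real.log ((max a₁ c₁ : ℕ) : ℝ) + Real.log ((max a₂ c₂ : ℕ) : ℝ) +
        Real.log ((UniqueFactorizationMonoid.radical d : ℕ) : ℝ)) * Real.log ((k : ℝ) + 2) + C'

/-- Specialising the uniform statement to the exponent `k = n` gives `DepthIneq n (C·log(n+2)) C'`. -/
theorem depthIneq_of_binomialXi {C C' : ℝ} (h : BinomialXi C C') (n : ℕ) :
    DepthIneq n (C * Real.log ((n : ℝ) + 2)) C' := by
  intro a₁ a₂ c₁ c₂ ha₁ ha₂ hc₁ hc₂ hcop hne d hd hdvd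
  have key := h n a₁ a₂ c₁ c₂ ha₁ ha₂ hc₁ hc₂ hcop hne d hd hdvd
  exact key.trans_eq (by ring)

/-- `log(n + 2) < 2·√(n + 2)` (from `log x ≤ x − 1` at `x = √(n+2)`). -/
theorem log_add_two_lt_two_mul_sqrt (n : ℕ) :
    Real.log ((n : ℝ) + 2) < 2 * Real.sqrt ((n : ℝ) + 2) := by
  have hn2 : (0 : ℝ) < (n : ℝ) + 2 := by positivity
  have hs : 0 < Real.sqrt ((n : ℝ) + 2) := Real.sqrt_pos.mpr hn2
  have h1 : Real.log (Real.sqrt ((n : ℝ) + 2)) ≤ Real.sqrt ((n : ℝ) + 2) - 1 :=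
    Real.log_le_sub_one_of_pos hs
  rw [Real.log_sqrt hn2.le] at h1
  linarith

/-- For `0 ≤ C` there is a level `n` with `3·(C·log(n+2)) < n`; `n = ⌈36C² + 2⌉₊` will do
(`3C log(n+2) < 6C√(n+2) ≤ n` as `36C²(n+2) ≤ n²`). -/
theorem exists_level_of_nonneg {C : ℝ} (hC : 0 ≤ C) :
    ∃ n : ℕ, 3 * (C * Real.log ((n : ℝ) + 2)) < n := by
  obtain ⟨n, hn⟩ := exists_nat_ge (36 * C ^ 2 + 2)
  refine ⟨n, ?_⟩
  have hn2 : (0 : ℝ) < (n : ℝ) + 2 := by positivity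
  have hr : (0 : ℝ) ≤ (n : ℝ) := Nat.cast_nonneg n
  set s : ℝ := Real.sqrt ((n : ℝ) + 2) with hs_def
  have hs0 : 0 ≤ s := Real.sqrt_nonneg _
  have hs2 : s ^ 2 = (n : ℝ) + 2 := Real.sq_sqrt hn2.le
  have hlog : Real.log ((n : ℝ) + 2) < 2 * s := log_add_two_lt_two_mul_sqrt n
  -- `6 C s ≤ n` by comparing squares
  have hsq : 6 * C * s ≤ n := by
    have hl : 0 ≤ 6 * C * s := by positivity
    have h2 : (6 * C * s) ^ 2 ≤ (n : ℝ) ^ 2 := by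
      have hprod : (36 * C ^ 2 + 2) * (n : ℝ) ≤ (n : ℝ) * n := mul_le_mul_of_nonneg_right hn hr
      calc (6 * C * s) ^ 2 = 36 * C ^ 2 * s ^ 2 := by ring
        _ = 36 * C ^ 2 * ((n : ℝ) + 2) := by rw [hs2]
        _ ≤ (n : ℝ) ^ 2 := by nlinarith [sq_nonneg C, hn, hprod]
    exact (pow_le_pow_iff_left₀ hl hr two_ne_zero).mp h2
  rcases hC.eq_or_lt with h0 | hpos
  · rw [← h0]
    have h2n : (2 : ℝ) ≤ n := le_trans (by nlinarith [sq_nonneg C]) hn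
    linarith
  · calc 3 * (C * Real.log ((n : ℝ) + 2)) = (3 * C) * Real.log ((n : ℝ) + 2) := by ring
      _ < (3 * C) * (2 * s) := mul_lt_mul_of_pos_left hlog (by positivity)
      _ = 6 * C * s := by ring
      _ ≤ n := hsq

/-- **Uniform Ξ ⟹ the lever**: `BinomialXi C C'` with `0 ≤ C` gives `BinomialDepthWindow` at any level `n` with
`3C·log(n+2) < n` — the window `3A < n` of the crux reappearing as the condition on the transcendence constant. -/
theorem binomialDepthWindow_of_binomialXi {C C' : ℝ} (hC : 0 ≤ C) (h : BinomialXi C C') :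
    BinomialDepthWindow := by
  obtain ⟨n, hn⟩ := exists_level_of_nonneg hC
  refine ⟨n, C * Real.log ((n : ℝ) + 2), C', ?_, hn, depthIneq_of_binomialXi h n⟩
  exact mul_nonneg hC (Real.log_nonneg (by have : (0 : ℝ) ≤ n := Nat.cast_nonneg n; linarith))

/-! ## Side theorem (proved): the lever is abc-SANDWICHED — `ABC ⟹ BinomialDepthWindow` (level `10`, `C = 3`).
Not used by the skeleton. It certifies that Stub A is consistent unless abc fails (so no refuter can kill the
line cheaply) and, read together with `TowerExponentWindow_of`, that the lever sits between `ABC` and polynomial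
abc. Proof: for `Q = c₁c₂¹⁰ < P = a₁a₂¹⁰`, `(P − Q, Q, P)` is an abc triple; abc at `ε = 1/10` and
`rad((P−Q)QP) ≤ rad d · (P−Q)/d · c₁c₂ · a₁a₂` give `1.1·log d < log K + 1.1 log rad d + 0.1 log P + 2.2(h₁ + h₂)`. -/

/-- Core of the sandwich, in the orientation `c₁c₂¹⁰ < a₁a₂¹⁰`. -/
theorem depth_core_of_abc {K : ℝ} (hK : 0 < K)
    (hABC : ∀ a b c : ℕ, IsABCTriple a b c → (c : ℝ) < K * ((rad a b c : ℕ) : ℝ) ^ (1 + (1 : ℝ) / 10))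
    {a₁ a₂ c₁ c₂ d : ℕ} (ha₁ : 0 < a₁) (ha₂ : 0 < a₂) (hc₁ : 0 < c₁) (hc₂ : 0 < c₂)
    (hcop : Nat.Coprime (a₁ * a₂) (c₁ * c₂)) (hlt : c₁ * c₂ ^ 10 < a₁ * a₂ ^ 10) (hd : 0 < d)
    (hdvd : (d : ℤ) ∣ ((a₁ * a₂ ^ 10 : ℕ) : ℤ) - ((c₁ * c₂ ^ 10 : ℕ) : ℤ)) :
    Real.log (d : ℝ) ≤ 3 * (Real.log ((max a₁ c₁ : ℕ) : ℝ) + Real.log ((max a₂ c₂ : ℕ) : ℝ) +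
      Real.log ((UniqueFactorizationMonoid.radical d : ℕ) : ℝ)) + max (Real.log K) 0 := by
  set P : ℕ := a₁ * a₂ ^ 10 with hPdef
  set Q : ℕ := c₁ * c₂ ^ 10 with hQdef
  have hP0 : 0 < P := by positivity
  have hQ0 : 0 < Q := by positivity
  -- `d ∣ P - Q` in `ℕ`
  obtain ⟨e, he⟩ : d ∣ P - Q := by
    have h1 : ((P - Q : ℕ) : ℤ) = (P : ℤ) - (Q : ℤ) := Nat.cast_sub hlt.le
    have h2 : (d : ℤ) ∣ ((P - Q : ℕ) : ℤ) := by rw [h1]; exact hdvd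
    exact Int.natCast_dvd_natCast.mp h2
  have hD0 : 0 < P - Q := Nat.sub_pos_of_lt hlt
  have he0 : 0 < e := by
    rcases Nat.eq_zero_or_pos e with h | h
    · rw [h, mul_zero] at he; omega
    · exact h
  -- `(P - Q, Q, P)` is an abc triple
  have hPd : P ∣ (a₁ * a₂) ^ 10 := by
    rw [mul_pow]; exact mul_dvd_mul (dvd_pow_self a₁ (by norm_num)) dvd_rfl
  have hQd : Q ∣ (c₁ * c₂) ^ 10 := by
    rw [mul_pow]; exact mul_dvd_mul (dvd_pow_self c₁ (by norm_num)) dvd_rfl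
  have hPQ : Nat.Coprime P Q :=
    Nat.Coprime.coprime_dvd_left hPd (Nat.Coprime.coprime_dvd_right hQd (Nat.Coprime.pow 10 10 hcop))
  have hDQ : Nat.Coprime (P - Q) Q := (Nat.coprime_sub_self_left hlt.le).mpr hPQ
  have habc3 : IsABCTriple (P - Q) Q P := ⟨hD0, hQ0, Nat.sub_add_cancel hlt.le, hDQ⟩
  have hmain := hABC _ _ _ habc3
  -- the radical bound in `ℕ`: `rad((P-Q)·Q·P) ≤ rad d · e · c₁c₂ · a₁a₂`
  have hDrad : UniqueFactorizationMonoid.radical (P - Q) ≤ UniqueFactorizationMonoid.radical d * e := by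
    rw [he]
    calc UniqueFactorizationMonoid.radical (d * e)
        ≤ UniqueFactorizationMonoid.radical d * UniqueFactorizationMonoid.radical e :=
          Nat.le_of_dvd (mul_pos (Nat.radical_pos _) (Nat.radical_pos _))
            UniqueFactorizationMonoid.radical_mul_dvd
      _ ≤ UniqueFactorizationMonoid.radical d * e :=
          Nat.mul_le_mul_left _ (Nat.radical_le_self_iff.mpr he0.ne')
  have hQrad : UniqueFactorizationMonoid.radical Q ≤ c₁ * c₂ :=
    radical_le_of_dvd_pow (n := 10) (by positivity) hQd
  have hPrad : UniqueFactorizationMonoid.radical P ≤ a₁ * a₂ :=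
    radical_le_of_dvd_pow (n := 10) (by positivity) hPd
  have hradN : rad (P - Q) Q P ≤ UniqueFactorizationMonoid.radical d * e * (c₁ * c₂) * (a₁ * a₂) := by
    rw [rad_def]
    exact (radical_mul_three_le _ _ _).trans (Nat.mul_le_mul (Nat.mul_le_mul hDrad hQrad) hPrad)
  -- real-side facts
  set R : ℝ := ((rad (P - Q) Q P : ℕ) : ℝ) with hRdef
  have hR1 : (1 : ℝ) ≤ R := Literature.Barriers.ABC.one_le_rad_real _ _ _
  have hR0 : 0 < R := by linarith
  have hPR : (0 : ℝ) < (P : ℝ) := by exact_mod_cast hP0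
  have hdR : (0 : ℝ) < (d : ℝ) := by exact_mod_cast hd
  have heR : (0 : ℝ) < (e : ℝ) := by exact_mod_cast he0
  have ha₁R : (0 : ℝ) < (a₁ : ℝ) := by exact_mod_cast ha₁
  have ha₂R : (0 : ℝ) < (a₂ : ℝ) := by exact_mod_cast ha₂
  have hc₁R : (0 : ℝ) < (c₁ : ℝ) := by exact_mod_cast hc₁
  have hc₂R : (0 : ℝ) < (c₂ : ℝ) := by exact_mod_cast hc₂
  have hrdR : (0 : ℝ) < ((UniqueFactorizationMonoid.radical d : ℕ) : ℝ) := by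
    exact_mod_cast Nat.radical_pos d
  -- (1) abc, logarithmically
  have h1 : Real.log (P : ℝ) < Real.log K + (1 + (1 : ℝ) / 10) * Real.log R := by
    have h := Real.log_lt_log hPR hmain
    rwa [Real.log_mul hK.ne' (Real.rpow_pos_of_pos hR0 _).ne', Real.log_rpow hR0] at h
  -- (2) the radical bound, logarithmically
  have h2 : Real.log R ≤ Real.log ((UniqueFactorizationMonoid.radical d : ℕ) : ℝ) + Real.log (e : ℝ) +
      (Real.log (c₁ : ℝ) + Real.log (c₂ : ℝ)) + (Real.log (a₁ : ℝ) + Real.log (a₂ : ℝ)) := by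
    have hcast : R ≤ ((UniqueFactorizationMonoid.radical d : ℕ) : ℝ) * (e : ℝ) * ((c₁ : ℝ) * (c₂ : ℝ)) *
        ((a₁ : ℝ) * (a₂ : ℝ)) := by
      rw [hRdef]; exact_mod_cast hradN
    have h := Real.log_le_log hR0 hcast
    rwa [Real.log_mul (mul_pos (mul_pos hrdR heR) (mul_pos hc₁R hc₂R)).ne' (mul_pos ha₁R ha₂R).ne',
      Real.log_mul (mul_pos hrdR heR).ne' (mul_pos hc₁R hc₂R).ne', Real.log_mul hrdR.ne' heR.ne',
      Real.log_mul hc₁R.ne' hc₂R.ne', Real.log_mul ha₁R.ne' ha₂R.ne'] at h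
  -- (3) `d · e = P - Q ≤ P`
  have h3 : Real.log (d : ℝ) + Real.log (e : ℝ) ≤ Real.log (P : ℝ) := by
    have hDP : ((P - Q : ℕ) : ℝ) ≤ (P : ℝ) := by exact_mod_cast Nat.sub_le P Q
    have hDe : ((P - Q : ℕ) : ℝ) = (d : ℝ) * (e : ℝ) := by rw [he]; push_cast; ring
    have h := Real.log_le_log (by rw [hDe]; positivity) hDP
    rwa [hDe, Real.log_mul hdR.ne' heR.ne'] at h
  -- (4) heights
  have h4 : Real.log (P : ℝ) = Real.log (a₁ : ℝ) + 10 * Real.log (a₂ : ℝ) := by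
    have : (P : ℝ) = (a₁ : ℝ) * (a₂ : ℝ) ^ 10 := by rw [hPdef]; push_cast; ring
    rw [this, Real.log_mul ha₁R.ne' (pow_pos ha₂R 10).ne', Real.log_pow]; push_cast; ring
  have h5a : Real.log (a₁ : ℝ) ≤ Real.log ((max a₁ c₁ : ℕ) : ℝ) :=
    Real.log_le_log ha₁R (by exact_mod_cast le_max_left a₁ c₁)
  have h5c : Real.log (c₁ : ℝ) ≤ Real.log ((max a₁ c₁ : ℕ) : ℝ) :=
    Real.log_le_log hc₁R (by exact_mod_cast le_max_right a₁ c₁)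
  have h6a : Real.log (a₂ : ℝ) ≤ Real.log ((max a₂ c₂ : ℕ) : ℝ) :=
    Real.log_le_log ha₂R (by exact_mod_cast le_max_left a₂ c₂)
  have h6c : Real.log (c₂ : ℝ) ≤ Real.log ((max a₂ c₂ : ℕ) : ℝ) :=
    Real.log_le_log hc₂R (by exact_mod_cast le_max_right a₂ c₂)
  have h7 : 0 ≤ Real.log ((max a₁ c₁ : ℕ) : ℝ) :=
    Real.log_nonneg (by exact_mod_cast (le_max_left a₁ c₁).trans' ha₁)
  have h8 : 0 ≤ Real.log ((max a₂ c₂ : ℕ) : ℝ) :=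
    Real.log_nonneg (by exact_mod_cast (le_max_left a₂ c₂).trans' ha₂)
  have h9 : 0 ≤ Real.log ((UniqueFactorizationMonoid.radical d : ℕ) : ℝ) :=
    Real.log_nonneg (by exact_mod_cast Nat.succ_le_of_lt (Nat.radical_pos d))
  have h10 : 0 ≤ Real.log (a₁ : ℝ) := Real.log_nonneg (by exact_mod_cast ha₁)
  have hm1 : Real.log K ≤ max (Real.log K) 0 := le_max_left _ _
  have hm2 : (0 : ℝ) ≤ max (Real.log K) 0 := le_max_right _ _
  linarith

/-- **`ABC ⟹ BinomialDepthWindow`** (level `n = 10`, constants `C = 3 < 10/3`, `C' = max (log K(1/10)) 0`). -/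
theorem binomialDepthWindow_of_abc (habc : _root_.ABC) : BinomialDepthWindow := by
  obtain ⟨K, hK, hABC⟩ := habc ((1 : ℝ) / 10) (by norm_num)
  refine ⟨10, 3, max (Real.log K) 0, by norm_num, by norm_num, ?_⟩
  intro a₁ a₂ c₁ c₂ ha₁ ha₂ hc₁ hc₂ hcop hne d hd hdvd
  rcases Nat.lt_or_gt_of_ne hne with hlt | hlt
  · -- `a₁a₂¹⁰ < c₁c₂¹⁰`: apply the core with the roles of `a` and `c` exchanged
    have h := depth_core_of_abc hK hABC hc₁ hc₂ ha₁ ha₂ hcop.symm hlt hd (dvd_sub_comm.mp hdvd)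
    rwa [max_comm c₁ a₁, max_comm c₂ a₂] at h
  · exact depth_core_of_abc hK hABC ha₁ ha₂ hc₁ hc₂ hcop hlt hd hdvd

end Summit.ABC.ABC.Cruxes.TowerExponentWindow.BinomialXiDZeroThreefold
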